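import Summits.QuantumFields.YangMills.Theorems.UnitScaleTiltProp8ChartText
import Summits.QuantumFields.YangMills.Theorems.UnitScaleTiltProp8FlatCubeQContraction
import Summits.QuantumFields.YangMills.Theorems.UnitScaleTiltProp8FlatCubeSequence
import Summits.QuantumFields.YangMills.Theorems.UnitScaleTiltProp8FlatCubeLevels
import Literature.MathematicalPhysics.QuantumFieldTheory.Balaban1983to89.T4ReflectionConeSharp
import Literature.MathematicalPhysics.QuantumFieldTheory.Balaban1983to89.BlockAveragingHaarAC
import HarnessLib

/-!
# Route `UnitScaleTilt`, crux K1 «MinimiserStabilityRegPr» (stmt-QuantumFields-19200), leaf V2′ `stub_halvingStep` — pillar P3 `ChartPerLevel`: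
# **THE READ SET OF AN INDEX BOND AND ITS TERRITORIES** (the «WHY ADMISSIBILITY» clause of the P3 text `ChartRemainderAt`, as theorems)

Cell `ym3-torus` ∕ fleet seat `ym-ust-19200-p2` g6 (v8 PEN).  The P3 text (p539223) bounds the multi-level constraint map `chartLog η D A (j, c)` of the
cube problem on the WEIGHTED sup-ball `w 1 b·‖A b‖ < R`, `w 1 b = L^{j(b₋)}·η` (`FlatCubeOpsText.IsLevWeight`; `j(x)` = the territory level of the fine site `x`,
`FlatCubeLevels.levOf_inOm_eq_iff`), for nested families `D` admissible in the sense (2.1)–(2.2) (`FlatCubeOpsText.Adm22`).  Its docstring explains WHY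
(2.2): without separation an index bond of `Λ_j` may read fine bonds of a territory `j′ ≪ j`, where the ball allows deviations `R·L^{−j′}/η`.  This file
proves the bookkeeping behind that sentence, for EVERY complete normed `ℂ`-algebra `𝔸`:
* §1 TWO-BLOCK LOCALITY of the unguarded (0.4) average `emlAvgU` on `𝔸ˣ`-valued fields: `Ū(c)` depends only on the bond variables with BOTH end-points in
  the two blocks of `c` (the tree's `blockOf_src/tgt_of_mem_walk` for the loops, `blockOf_lineSite`/`blockOf_tgt_line` for the straight line; companion of
  `T4ReflectionConeSharp.avgFun_congr₂` for the guarded `SU(N)` average);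
* §2 its iterate: `Ū^{(j)}(c)` and `chartLog η D A (j, c)` depend only on the fine bonds `b` whose `j`-fold block points `Bʲ(b₋), Bʲ(b₊)` lie in `{c₋, c₊}`
  (**`chartLog_congr`** — the READ SET of the index `(j, c)`);
* §3 TERRITORIES OF THE READ SET: for an index bond `c ∈ Λ_j` (`B6SectAOperatorsV1.BondIdx D`) every read fine site has territory level `≤ j`
  (**`levOf_le_of_read`**, nestedness alone) and, when both blocks of every index bond of level `i + 1` are filled by `Ω_i` (the COLLAR property
  **`Collar D`-shaped hypothesis**, discharged from `Adm22 D R M` with `2L ≤ R·M + 1` in **`collar_of_adm22`** through the cross-level distance inequality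
  `FlatCubeSequence.distSite_le_blockOf`), level `≥ j − 1` (**`le_levOf_succ_of_read`**);
* §4 hence on the weighted ball the bond variables read by a level-`j` index satisfy the k-UNIFORM letter `η·Lʲ·‖A b‖ < L·R` (**`weighted_read_bound`**), the
  smallness every conjunct (hCd/hCq/hH) of `ChartRemainderAt` starts from.
Sorry-free, definition-free (the collar property is a hypothesis spelled inline, not a `def`).  NOT a claim about the mass gap.

References: T. Bałaban, CMP **96** (1984) 223–250 [Balaban1984PropagatorsII] ((2.1)–(2.4) p.224); CMP **102** (1985) 277–309 [Balaban1985Variational]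
((44)–(48) p.285, (144)–(152) pp.300–301); CMP **109** (1987) 249–301 [Balaban1987RG1] ((0.3)–(0.4) pp.252–253).
-/

noncomputable section

open scoped BigOperators

namespace Summit.QuantumFields.YangMills.Theorems.Prop8Chart

open Literature.MathematicalPhysics.QuantumFieldTheory.Balaban1983to89
open T4Continuum BlockAveraging AveragingRT ExpMeanLog MatrixLog
open B10Eq27TorusAxialLog (holT holT_nil holT_cons_true holT_cons_false)
open B6SectADomainsV1 (Domains)
open B6SectAOperatorsV1 (BondIdx)
open B5Eq118OneStroke (iterBlockOf iterBlockOf_succ iterBlockOf_zero)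
open B5Eq117TorusCarriers (Mk)
open B5Prop12FieldsLattice (distSite)
open B11Eq115Space (levOf)
open T3ContinuumYM3Torus (T3Family)
open Summit.QuantumFields.YangMills.Theorems.FlatCubeOpsText (Adm22 IsLevWeight)
open Summit.QuantumFields.YangMills.Theorems.FlatCubeLevels (levOf_inOm_eq_iff lamSite_levOf_inOm)

variable {P : Params} {j : ℕ}

/-! ## §1 Two-block locality of the unguarded (0.4) average -/

section TwoBlock

/-- A transport along a word depends only on the bond variables of the steps of its walk. [cite: Balaban1985Averaging, (9) p.18] -/
theorem holT_congr {G : Type*} [Group G] {U U' : GaugeField P j G} :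
    ∀ (w : List (Letter P.d)) (x : Site P j), (∀ s ∈ walk x w, U s.bond = U' s.bond) → holT U x w = holT U' x w
  | [], x, _ => by rw [holT_nil, holT_nil]
  | (μ, true) :: w, x, h => by
    rw [holT_cons_true, holT_cons_true, h ⟨⟨x, μ⟩, true⟩ (by simp [walk]),
      holT_congr w (x.shift μ) fun s hs => h s (by simp [walk, hs])]
  | (μ, false) :: w, x, h => by
    rw [holT_cons_false, holT_cons_false, h ⟨⟨x.unshift μ, μ⟩, false⟩ (by simp [walk]),
      holT_congr w (x.unshift μ) fun s hs => h s (by simp [walk, hs])]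

/-- The steps of the straight walk of `c` are the line bonds `line c t`, `t < L`. [cite: Balaban1984PropagatorsI, (1.7) p.18] -/
theorem exists_eq_line_of_mem_walk (c : PBond P (j + 1)) {s : LStep P j} (hs : s ∈ walk (emb c.src) (List.replicate P.L (c.dir, true))) :
    ∃ t, t < P.L ∧ s.bond = line c t := by
  obtain ⟨hdir, -, t, ht, hsrc⟩ := BlockAveragingHaarAC.mem_walk_replicate hs
  refine ⟨t, ht, ?_⟩
  have hsite : s.bond.src = lineSite c t := by
    funext ν
    rw [hsrc ν, lineSite]
    by_cases hν : ν = c.dir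
    · subst hν; simp
    · simp [hν]
  cases hb : s.bond with
  | mk src dir =>
    rw [hb] at hsite hdir
    simp only at hsite hdir
    rw [line, ← hsite, ← hdir]

variable {G : Type*} [Group G]

/-- The (0.4) loop variables at `c` of two `G`-valued fields agreeing on the bonds with both ends in `B(c₋) ∪ B(c₊)` agree. [cite: Balaban1987RG1, (0.4) p.253] -/
theorem holT_loopWord_congr₂ (hj : j + 1 ≤ P.m + P.K) {U U' : GaugeField P j G} (c : PBond P (j + 1))
    (hUU' : ∀ b : PBond P j, (blockOf b.src = c.src ∨ blockOf b.src = c.tgt) → (blockOf b.tgt = c.src ∨ blockOf b.tgt = c.tgt) → U b = U' b)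
    (i : Idx P) :
    holT U (emb c.src) (loopWord P.L c.dir (off i.1) i.2.1 i.2.2) = holT U' (emb c.src) (loopWord P.L c.dir (off i.1) i.2.1 i.2.2) :=
  holT_congr _ _ fun s hs => hUU' s.bond (blockOf_src_of_mem_walk hj c i s hs) (T4ReflectionConeSharp.blockOf_tgt_of_mem_walk hj c i s hs)

/-- The straight transporter of `c` of two fields agreeing on the bonds with both ends in `B(c₋) ∪ B(c₊)` agree. [cite: Balaban1984PropagatorsI, (1.7) p.18] -/
theorem holT_replicate_congr₂ (hj : j + 1 ≤ P.m + P.K) {U U' : GaugeField P j G} (c : PBond P (j + 1))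
    (hUU' : ∀ b : PBond P j, (blockOf b.src = c.src ∨ blockOf b.src = c.tgt) → (blockOf b.tgt = c.src ∨ blockOf b.tgt = c.tgt) → U b = U' b) :
    holT U (emb c.src) (List.replicate P.L (c.dir, true)) = holT U' (emb c.src) (List.replicate P.L (c.dir, true)) :=
  holT_congr _ _ fun s hs => by
    obtain ⟨t, ht, hb⟩ := exists_eq_line_of_mem_walk c hs
    rw [hb]
    exact hUU' (line c t) (blockOf_lineSite hj c ht) (T4ReflectionConeSharp.blockOf_tgt_line hj c ht)

variable {𝔸 : Type*} [NormedRing 𝔸] [NormedAlgebra ℂ 𝔸] [CompleteSpace 𝔸]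

/-- **THE UNGUARDED (0.4) AVERAGE IS TWO-BLOCK LOCAL**: `(emlAvgU U)(c)` depends only on the bond variables `U(b)` with BOTH end-points in the two blocks of
`c` (`blockOf b₋, blockOf b₊ ∈ {c₋, c₊}`) — all loops `Γ ∪ [x,x′] ∪ (−Γ′) ∪ (−c)` and the straight line of `c` lie there.  Companion of the guarded
`T4ReflectionConeSharp.avgFun_congr₂`. [cite: Balaban1987RG1, (0.4) p.253] -/
theorem emlAvgU_congr₂ (hj : j + 1 ≤ P.m + P.K) {U U' : GaugeField P j 𝔸ˣ} (c : PBond P (j + 1))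
    (hUU' : ∀ b : PBond P j, (blockOf b.src = c.src ∨ blockOf b.src = c.tgt) → (blockOf b.tgt = c.src ∨ blockOf b.tgt = c.tgt) → U b = U' b) :
    emlAvgU U c = emlAvgU U' c := by
  apply Units.ext
  rw [coe_emlAvgU, coe_emlAvgU]
  have hloop : (fun i : Idx P => ((loopHolU U c i : 𝔸ˣ) : 𝔸)) = fun i => ((loopHolU U' c i : 𝔸ˣ) : 𝔸) := by
    funext i; unfold loopHolU; rw [holT_loopWord_congr₂ hj c hUU' i]
  rw [hloop, holT_replicate_congr₂ hj c hUU']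

end TwoBlock

/-! ## §2 The read set of the iterated average and of the multi-level constraint map -/

section ReadSet

variable {𝔸 : Type*} [NormedRing 𝔸] [NormedAlgebra ℂ 𝔸] [CompleteSpace 𝔸]

/-- **THE `j`-FOLD UNGUARDED AVERAGE AT `c` READS ONLY THE FINE BONDS UNDER THE TWO `j`-BLOCKS OF `c`**: if `U`, `U′` agree on every finest-lattice bond `b`
whose `j`-fold block points `Bʲ(b₋)`, `Bʲ(b₊)` (`B5Eq118OneStroke.iterBlockOf j`) lie in `{c₋, c₊}`, then `Ū^{(j)}(c) = Ū′^{(j)}(c)` (induction over the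
levels with §1). [cite: Balaban1987RG1, (0.4) p.253, (0.21) p.256] -/
theorem emlIterU_congr_of_agree :
    ∀ (j : ℕ), j ≤ P.m + P.K → ∀ {U U' : GaugeField P 0 𝔸ˣ} (c : PBond P j),
      (∀ b : PBond P 0, (iterBlockOf j b.src = c.src ∨ iterBlockOf j b.src = c.tgt) →
        (iterBlockOf j b.tgt = c.src ∨ iterBlockOf j b.tgt = c.tgt) → U b = U' b) →
      emlIterU j U c = emlIterU j U' c
  | 0, _, U, U', c, h => by
    rw [emlIterU_zero, emlIterU_zero]
    exact h c (Or.inl rfl) (Or.inr rfl)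
  | j + 1, hj, U, U', c, h => by
    rw [emlIterU_succ, emlIterU_succ]
    refine emlAvgU_congr₂ hj c fun e hes het => emlIterU_congr_of_agree j (Nat.le_of_succ_le hj) e fun b hbs hbt => h b ?_ ?_
    · rw [iterBlockOf_succ]
      rcases hbs with h1 | h1 <;> rw [h1]
      · exact hes
      · exact het
    · rw [iterBlockOf_succ]
      rcases hbt with h1 | h1 <;> rw [h1]
      · exact hes
      · exact het

/-- **THE READ SET OF AN INDEX: `chartLog η D A (j, c)` DEPENDS ONLY ON `A` ON THE FINE BONDS UNDER THE TWO `j`-BLOCKS OF `c`** (`Bʲ(b₋), Bʲ(b₊) ∈ {c₋, c₊}`).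
[cite: Balaban1985Variational, (156) p.302; Balaban1987RG1, (0.4) p.253] -/
theorem chartLog_congr (η : ℝ) (D : Domains P) {A A' : PBond P 0 → 𝔸} (idx : BondIdx D)
    (h : ∀ b : PBond P 0, (iterBlockOf (idx.1.1 : ℕ) b.src = idx.1.2.src ∨ iterBlockOf (idx.1.1 : ℕ) b.src = idx.1.2.tgt) →
      (iterBlockOf (idx.1.1 : ℕ) b.tgt = idx.1.2.src ∨ iterBlockOf (idx.1.1 : ℕ) b.tgt = idx.1.2.tgt) → A b = A' b) :
    chartLog η D A idx = chartLog η D A' idx := by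
  have hj : (idx.1.1 : ℕ) ≤ P.m + P.K := (Nat.lt_succ_iff.mp idx.1.1.isLt).trans D.hk
  rw [chartLog_apply, chartLog_apply, emlIterU_congr_of_agree (idx.1.1 : ℕ) hj idx.1.2 fun b hbs hbt => ?_]
  apply Units.ext
  rw [coe_expCfg, coe_expCfg, h b hbs hbt]

/-- The same for the tree-normalised reading `chartQ`. [cite: Balaban1985Variational, (156) p.302] -/
theorem chartQ_congr (η : ℝ) (D : Domains P) {A A' : PBond P 0 → 𝔸} (idx : BondIdx D)
    (h : ∀ b : PBond P 0, (iterBlockOf (idx.1.1 : ℕ) b.src = idx.1.2.src ∨ iterBlockOf (idx.1.1 : ℕ) b.src = idx.1.2.tgt) →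
      (iterBlockOf (idx.1.1 : ℕ) b.tgt = idx.1.2.src ∨ iterBlockOf (idx.1.1 : ℕ) b.tgt = idx.1.2.tgt) → A b = A' b) :
    chartQ η D A idx = chartQ η D A' idx := by
  have hj : (idx.1.1 : ℕ) ≤ P.m + P.K := (Nat.lt_succ_iff.mp idx.1.1.isLt).trans D.hk
  rw [chartQ_apply, chartQ_apply, emlIterU_congr_of_agree (idx.1.1 : ℕ) hj idx.1.2 fun b hbs hbt => ?_]
  apply Units.ext
  rw [coe_expCfg, coe_expCfg, h b hbs hbt]

end ReadSet

/-! ## §3 Territories of the read set -/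

section Territory

variable (D : Domains P)

/-- **NESTEDNESS ALONE: A FINE SITE READ BY AN INDEX BOND OF LEVEL `j` HAS TERRITORY LEVEL `≤ j`** — its `j`-block is an end-point of `c ∈ Λ_j`, hence not inside
`B(Ω_{j+1})`, so the site lies outside `Ω_{j′}` for every `j′ > j`. [cite: Balaban1984PropagatorsII, (2.3)-(2.4) p.224] -/
theorem levOf_le_of_read (idx : BondIdx D) (x : Site P 0)
    (hx : iterBlockOf (idx.1.1 : ℕ) x = idx.1.2.src ∨ iterBlockOf (idx.1.1 : ℕ) x = idx.1.2.tgt) :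
    levOf (fun i => {y : Site P 0 | D.InOm i y}) D.k x ≤ (idx.1.1 : ℕ) := by
  set j₀ := levOf (fun i => {y : Site P 0 | D.InOm i y}) D.k x with hj₀
  have hlam : D.LamSite j₀ (iterBlockOf j₀ x) := lamSite_levOf_inOm D x
  by_contra hlt
  have hlt : (idx.1.1 : ℕ) < j₀ := not_le.mp hlt
  have hnd : ¬ D.Deep (idx.1.1 : ℕ) (iterBlockOf (idx.1.1 : ℕ) x) := by
    rcases hx with h1 | h1 <;> rw [h1]
    · exact idx.2.2.1
    · exact idx.2.2.2
  exact D.not_inOm_of_not_deep hlt hnd hlam.1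

/-- **THE COLLAR PROPERTY ⇒ A FINE SITE READ BY AN INDEX BOND OF LEVEL `j + 1` HAS TERRITORY LEVEL `≥ j`**: if both blocks of every index bond of level `i + 1` are
filled by `Ω_i` (in particular the block of a straddling end-point outside `Ω_{i+1}`), the `j`-block of a read site lies in `Ω_j`.
[cite: Balaban1984PropagatorsII, (2.1)-(2.4) p.224] -/
theorem le_levOf_of_read_succ
    (hcollar : ∀ (i : ℕ) (e : PBond P (i + 1)), D.LamBond (i + 1) e → ∀ z : Site P i, (blockOf z = e.src ∨ blockOf z = e.tgt) → z ∈ D.Om i)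
    (idx : BondIdx D) {j : ℕ} (hj : (idx.1.1 : ℕ) = j + 1) (x : Site P 0)
    (hx : iterBlockOf (idx.1.1 : ℕ) x = idx.1.2.src ∨ iterBlockOf (idx.1.1 : ℕ) x = idx.1.2.tgt) :
    j ≤ levOf (fun i => {y : Site P 0 | D.InOm i y}) D.k x := by
  obtain ⟨⟨⟨jv, hjv⟩, e⟩, he⟩ := idx
  simp only at hj hx he
  subst hj
  -- the `j`-block of `x` lies in `Ω_j`
  have hin : D.InOm j x := hcollar j e he (iterBlockOf j x) (by simpa only [iterBlockOf_succ] using hx)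
  set j₀ := levOf (fun i => {y : Site P 0 | D.InOm i y}) D.k x with hj₀
  have hlam : D.LamSite j₀ (iterBlockOf j₀ x) := lamSite_levOf_inOm D x
  by_contra hlt
  have hlt : j₀ < j := not_le.mp hlt
  exact D.not_inOm_of_not_deep hlt hlam.2 hin

/-- `2L − 1 < R·M` is incompatible with two `i`-sites in the blocks of ONE `(i+1)`-bond being more than `R·M` apart: the cross-level distance inequality
`dist_i(z, y) ≤ L·dist_{i+1}(B(z), B(y)) + (L − 1)` and `dist_{i+1}(e₋, e₊) ≤ 1`. [cite: Balaban1984PropagatorsII, (2.2) p.224] -/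
theorem distSite_le_of_blocks_endpoints {i : ℕ} (hi : i + 1 ≤ P.m + P.K) (e : PBond P (i + 1)) (z y : Site P i)
    (hz : blockOf z = e.src ∨ blockOf z = e.tgt) (hy : blockOf y = e.src ∨ blockOf y = e.tgt) :
    distSite (Mk P i) y z ≤ 2 * (P.L : ℝ) - 1 := by
  have h1 : distSite (Mk P (i + 1)) (blockOf y) (blockOf z) ≤ 1 := by
    have := FlatCubeQContraction.distSite_endpoints_le_one e
      (y := blockOf z) (y' := blockOf y) (by rcases hz with h | h <;> simp [h]) (by rcases hy with h | h <;> simp [h])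
    exact this
  have h2 := FlatCubeSequence.distSite_le_blockOf hi y z
  have hL : (0 : ℝ) ≤ P.L := Nat.cast_nonneg _
  nlinarith

/-- **(2.2)-ADMISSIBILITY WITH `2L ≤ R·M + 1` GIVES THE COLLAR PROPERTY**: both blocks of every index bond `e ∈ Λ_{i+1}` are filled by `Ω_i^{(i)}` — the block of
an end-point in `Ω_{i+1}` by nestedness, the block of a straddling end-point outside `Ω_{i+1}` by the separation `dist_i(Ω_{i+1}, Ω_iᶜ) > R·M ≥ 2L − 1`
(the two blocks of one bond are within `2L − 1` at level `i`). [cite: Balaban1984PropagatorsII, (2.1)-(2.2) p.224; Balaban1985RegularSpaces, (1.3)-(1.4) p.77] -/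
theorem collar_of_adm22 {R M : ℕ} (hAdm : Adm22 D R M) (hRM : 2 * P.L ≤ R * M + 1) :
    ∀ (i : ℕ) (e : PBond P (i + 1)), D.LamBond (i + 1) e → ∀ z : Site P i, (blockOf z = e.src ∨ blockOf z = e.tgt) → z ∈ D.Om i := by
  intro i e he z hz
  have hi : i + 1 ≤ P.m + P.K := (D.le_of_lamBond he).trans D.hk
  obtain ⟨hends, -, -⟩ := he
  by_contra hzout
  -- the other end-point of `e` lies in `Ω_{i+1}`: otherwise the block of `z` does (nestedness closes the case)
  have key : ∀ w : Site P (i + 1), w ∈ D.Om (i + 1) → (w = e.src ∨ w = e.tgt) → False := by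
    intro w hw hwe
    -- a deep `i`-site under `w`
    have hdeep : blockOf (emb w) ∈ D.Om (i + 1) := by rw [Site.blockOf_emb hi]; exact hw
    have hsep := hAdm.2 i (emb w) z hdeep hzout
    have hdist := distSite_le_of_blocks_endpoints hi e z (emb w) hz (by rw [Site.blockOf_emb hi]; rcases hwe with h | h <;> simp [h])
    have hcast : ((R * M : ℕ) : ℝ) ≥ 2 * (P.L : ℝ) - 1 := by
      have : (2 * P.L : ℝ) ≤ (R * M : ℕ) + 1 := by exact_mod_cast hRM
      linarith
    linarith
  rcases hends with h | h
  · exact key e.src h (Or.inl rfl)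
  · exact key e.tgt h (Or.inr rfl)

end Territory

/-! ## §4 The weighted ball read through an index bond -/

section Weighted

variable {V : Type*} [SeminormedAddCommGroup V]

/-- **ON THE WEIGHTED BALL, THE BONDS READ BY A LEVEL-`j` INDEX OBEY THE k-UNIFORM LETTER `η·Lʲ·‖A b‖ < L·R`** (`η = L^{−(K−n)}`, weights
`w 1 b = L^{j(b₋)}·η` of `FlatCubeOpsText.IsLevWeight`, collar property): the territory level of a read site is `≥ j − 1`, so its weight is `≥ L^{j−1}·η`.
This is the smallness of the charted bond variables `e^{iηA(b)}` seen by `chartLog η D A (j, c)` from which Props. 3–4 start, uniformly in `j` and `k`.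
[cite: Balaban1985Variational, (44)-(48) p.285, (152) p.301; Balaban1984PropagatorsII, (2.2) p.224] -/
theorem weighted_read_bound (F : T3Family) (n K : ℕ) (D : Domains (F.P K)) (hDk : D.k = K - n)
    (hcollar : ∀ (i : ℕ) (e : PBond (F.P K) (i + 1)), D.LamBond (i + 1) e → ∀ z : Site (F.P K) i, (blockOf z = e.src ∨ blockOf z = e.tgt) → z ∈ D.Om i)
    {w : ℕ → PBond (F.P K) 0 → ℝ} (hw : IsLevWeight F n K D w) {A : PBond (F.P K) 0 → V} {R : ℝ} (hA : ∀ b, w 1 b * ‖A b‖ < R)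
    (idx : BondIdx D) (b : PBond (F.P K) 0)
    (hb : iterBlockOf (idx.1.1 : ℕ) b.src = idx.1.2.src ∨ iterBlockOf (idx.1.1 : ℕ) b.src = idx.1.2.tgt) :
    ((F.L : ℝ)⁻¹) ^ (K - n) * (F.L : ℝ) ^ (idx.1.1 : ℕ) * ‖A b‖ < (F.L : ℝ) * R := by
  have hL1 : (1 : ℝ) ≤ F.L := by exact_mod_cast (F.P K).L_pos
  have hL0 : (0 : ℝ) < F.L := by linarith
  have hR : 0 < R := by
    have h := hA b
    have hw0 : 0 ≤ w 1 b * ‖A b‖ := by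
      rw [hw 1 b, pow_one]
      exact mul_nonneg (by positivity) (norm_nonneg _)
    linarith
  -- the weight of `b` is at least `L^{j-1}·η`
  set lev := levOf (fun i => {y : Site (F.P K) 0 | D.InOm i y}) D.k b.src with hlev
  have hlevK : levOf (fun i => {y : Site (F.P K) 0 | D.InOm i y}) (K - n) b.src = lev := by rw [hlev, hDk]
  have hwb : w 1 b = (F.L : ℝ) ^ lev * ((F.L : ℝ)⁻¹) ^ (K - n) := by rw [hw 1 b, pow_one, hlevK]
  have hlevj : (idx.1.1 : ℕ) ≤ lev + 1 := by
    rcases Nat.eq_zero_or_eq_succ_pred (idx.1.1 : ℕ) with h0 | hsucc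
    · rw [h0]; exact Nat.zero_le _
    · have h := le_levOf_of_read_succ D hcollar idx hsucc b.src hb
      rw [hsucc]
      exact Nat.succ_le_succ h
  have hpow : (F.L : ℝ) ^ (idx.1.1 : ℕ) ≤ (F.L : ℝ) * (F.L : ℝ) ^ lev := by
    calc (F.L : ℝ) ^ (idx.1.1 : ℕ) ≤ (F.L : ℝ) ^ (lev + 1) := pow_le_pow_right₀ hL1 hlevj
      _ = (F.L : ℝ) * (F.L : ℝ) ^ lev := by rw [pow_succ, mul_comm]
  have hη0 : 0 < ((F.L : ℝ)⁻¹) ^ (K - n) := by positivity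
  calc ((F.L : ℝ)⁻¹) ^ (K - n) * (F.L : ℝ) ^ (idx.1.1 : ℕ) * ‖A b‖
      ≤ ((F.L : ℝ)⁻¹) ^ (K - n) * ((F.L : ℝ) * (F.L : ℝ) ^ lev) * ‖A b‖ := by gcongr
    _ = (F.L : ℝ) * (w 1 b * ‖A b‖) := by rw [hwb]; ring
    _ < (F.L : ℝ) * R := by gcongr; exact hA b

/-- The same with the collar property discharged from (2.2)-admissibility (`2L ≤ R′·M + 1`). [cite: Balaban1984PropagatorsII, (2.2) p.224; Balaban1985Variational, (152) p.301] -/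
theorem weighted_read_bound_of_adm22 (F : T3Family) (n K : ℕ) (D : Domains (F.P K)) (hDk : D.k = K - n) {R' M : ℕ} (hAdm : Adm22 D R' M)
    (hRM : 2 * (F.P K).L ≤ R' * M + 1)
    {w : ℕ → PBond (F.P K) 0 → ℝ} (hw : IsLevWeight F n K D w) {A : PBond (F.P K) 0 → V} {R : ℝ} (hA : ∀ b, w 1 b * ‖A b‖ < R)
    (idx : BondIdx D) (b : PBond (F.P K) 0)
    (hb : iterBlockOf (idx.1.1 : ℕ) b.src = idx.1.2.src ∨ iterBlockOf (idx.1.1 : ℕ) b.src = idx.1.2.tgt) :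
    ((F.L : ℝ)⁻¹) ^ (K - n) * (F.L : ℝ) ^ (idx.1.1 : ℕ) * ‖A b‖ < (F.L : ℝ) * R :=
  weighted_read_bound F n K D hDk (collar_of_adm22 D hAdm hRM) hw hA idx b hb

end Weighted

end Summit.QuantumFields.YangMills.Theorems.Prop8Chart

end
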